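import Mathlib
import HarnessLib
import Summits.HubbardSuperconductivity.HubbardSuperconductivity.Theorems.KLProgrammePerturbedFermiCurveTwoFrameTower
import Summits.HubbardSuperconductivity.HubbardSuperconductivity.Theorems.KLProgrammePerturbedFermiCurveHigherDerivsBand
import Summits.HubbardSuperconductivity.HubbardSuperconductivity.Theorems.KLProgrammePerturbedFermiCurveTwoFrame
import Summits.HubbardSuperconductivity.HubbardSuperconductivity.Theorems.KLProgrammeH10TwoPointLimitPolarGridCount

/-!
# Route `KLProgramme` — two perturbed bands `ε₀ + δ`, `ε₀ + δ′`: the radii and their first two angular derivatives differ by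
# amounts LINEAR in `sup|δ′ − δ|`, `sup‖Dδ′ − Dδ‖`, `sup‖D²δ′ − D²δ‖` (BGM 2006 Lemma 2.1, two frames, orders 0–2)

Cell `gate-hubbard-kl`, seat hubbard-kl-k3c3-p3 (g3; row «implicit-function / monotonicity route»).  Instantiation of the pointwise two-curve
algebra `…PerturbedFermiCurveTwoFrameTower` (orders 1–2) at the lineage's perturbed band, with the derivative DIFFERENCES at the two curve
points split as «one function, two points» (Lipschitz of `Dʲ(ε₀ + δ)` on the closed square, constant `4 + κ_{j+1}`) + «two functions, one
point» (`‖Dʲδ′ − Dʲδ‖ ≤ E_j`).  For the ENGINE child's two-leg stubs (stmt-HubbardSuperconductivity-19855), clause (E3a-MS): with `δ = −K^{(m−1)}`,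
`δ′ = −K^{(m)}` (partial frames) the `E_j = ‖Dʲ Kp_m‖`-terms are the slot-`m` allowances and everything here is LINEAR in them
(HOME/hubbard-kl-k3c3-p3/MS-CUT.md §3, §5).

* §1 `norm_fderiv_pertBand_sub_le` / `norm_fderiv_two_pertBand_sub_le`: `‖D(ε₀+δ)(x) − D(ε₀+δ)(y)‖ ≤ (4 + κ₂)‖x − y‖`,
  `‖D²(ε₀+δ)(x) − D²(ε₀+δ)(y)‖ ≤ (4 + κ₃)‖x − y‖` on the closed square (mean value on the lineage's `convex_closedSquare`); the two-function splits `fderiv_pertBand_sub`,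
  `fderiv_two_pertBand_sub`.
* §2 for root selections `u` of `ε₀ + δ` and `v` of `ε₀ + δ′` (common `κ₀, κ₁ < Dt_min, κ₂`; `κ₃` for `δ`):
  `abs_root_sub_root_le`: `|v − u| ≤ E₀/(Dt_min − κ₁)` (p1b's order 0, named for root selections);
  `abs_deriv_root_sub_le`: `|v′ − u′| ≤ ((4+κ₁)W₀ + (π√2 + R₁)((4+κ₂)W₀ + E₁))/(Dt_min − κ₁)`, `W₀ = E₀/(Dt_min − κ₁)`;
  `abs_deriv_two_root_sub_le`: the order-2 difference with `Δ₁ = (4+κ₂)W₀ + E₁`, `Δ₂ = (4+κ₃)W₀ + E₂` in `abs_deriv_two_sub_le_of_polar_levels`.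

Everything is PROVED; no definitions; nothing about the Hubbard model.  References: BGM 2006 §2.4 Lemma 2.1 (2.40)
[cite: BenfattoGiulianiMastropietro2006]; FST IV, CPAM 53 (2000) 1350, Thm 2.
-/

noncomputable section

namespace Summit.HubbardSuperconductivity.HubbardSuperconductivity.Theorems.PerturbedFermiCurve

set_option linter.dupNamespace false -- summit = problem name (single-conjunct summit), D-0017
set_option maxSynthPendingDepth 3 -- nested operator-norm instances (second/third Fréchet derivatives)

open Real Set
open Literature.MathematicalPhysics.QuantumLattice Literature.MathematicalPhysics.QuantumLattice.BandSectorCounting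

/-! ## §1 Lipschitz of `D(ε₀+δ)`, `D²(ε₀+δ)` on the closed square; the two-function splits -/

section OneBand

variable {δ : (Fin 2 → ℝ) → ℝ} (hδs : ContDiff ℝ 4 δ)
include hδs

/-- `‖D²(ε₀ + δ)(k)‖ ≤ 4 + κ₂` at every point of the closed square. [folklore] -/
theorem norm_fderiv_two_pertBand_le_of_mem {κ₂ : ℝ} (hκ₂ : ∀ k : Fin 2 → ℝ, (∀ i, |k i| ≤ π) → ‖fderiv ℝ (fderiv ℝ δ) k‖ ≤ κ₂)
    {k : Fin 2 → ℝ} (hk : ∀ i, |k i| ≤ π) : ‖fderiv ℝ (fderiv ℝ (fun k : Fin 2 → ℝ => sqDispersion k + δ k)) k‖ ≤ 4 + κ₂ := by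
  rw [norm_fderiv_two_eq_norm_iteratedFDeriv, show (fun k : Fin 2 → ℝ => sqDispersion k + δ k) = sqDispersion + δ from rfl,
    iteratedFDeriv_add_apply contDiff_sqDispersion.contDiffAt (hδs.of_le (by norm_num)).contDiffAt]
  refine (norm_add_le _ _).trans (add_le_add (norm_iteratedFDeriv_sqDispersion_le 2 _) ?_)
  rw [← norm_fderiv_two_eq_norm_iteratedFDeriv]; exact hκ₂ _ hk

/-- `‖D³(ε₀ + δ)(k)‖ ≤ 4 + κ₃` at every point of the closed square. [folklore] -/
theorem norm_fderiv_three_pertBand_le_of_mem {κ₃ : ℝ}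
    (hκ₃ : ∀ k : Fin 2 → ℝ, (∀ i, |k i| ≤ π) → ‖fderiv ℝ (fderiv ℝ (fderiv ℝ δ)) k‖ ≤ κ₃) {k : Fin 2 → ℝ} (hk : ∀ i, |k i| ≤ π) :
    ‖fderiv ℝ (fderiv ℝ (fderiv ℝ (fun k : Fin 2 → ℝ => sqDispersion k + δ k))) k‖ ≤ 4 + κ₃ := by
  rw [norm_fderiv_three_eq_norm_iteratedFDeriv, show (fun k : Fin 2 → ℝ => sqDispersion k + δ k) = sqDispersion + δ from rfl,
    iteratedFDeriv_add_apply contDiff_sqDispersion.contDiffAt (hδs.of_le (by norm_num)).contDiffAt]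
  refine (norm_add_le _ _).trans (add_le_add (norm_iteratedFDeriv_sqDispersion_le 3 _) ?_)
  rw [← norm_fderiv_three_eq_norm_iteratedFDeriv]; exact hκ₃ _ hk

/-- **`D(ε₀ + δ)` is `(4 + κ₂)`-Lipschitz on the closed square.** [folklore] -/
theorem norm_fderiv_pertBand_sub_le {κ₂ : ℝ} (hκ₂ : ∀ k : Fin 2 → ℝ, (∀ i, |k i| ≤ π) → ‖fderiv ℝ (fderiv ℝ δ) k‖ ≤ κ₂)
    {x y : Fin 2 → ℝ} (hx : ∀ i, |x i| ≤ π) (hy : ∀ i, |y i| ≤ π) :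
    ‖fderiv ℝ (fun k : Fin 2 → ℝ => sqDispersion k + δ k) x - fderiv ℝ (fun k : Fin 2 → ℝ => sqDispersion k + δ k) y‖ ≤
      (4 + κ₂) * ‖x - y‖ := by
  have hC : ContDiff ℝ 3 (fderiv ℝ (fun k : Fin 2 → ℝ => sqDispersion k + δ k)) := (contDiff_pertBand hδs).fderiv_right (by norm_num)
  exact (convex_closedSquare).norm_image_sub_le_of_norm_fderiv_le (fun z _ => (hC.differentiable (by norm_num)) z)
    (fun z hz => norm_fderiv_two_pertBand_le_of_mem hδs hκ₂ hz) hy hx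

/-- **`D²(ε₀ + δ)` is `(4 + κ₃)`-Lipschitz on the closed square.** [folklore] -/
theorem norm_fderiv_two_pertBand_sub_le {κ₃ : ℝ}
    (hκ₃ : ∀ k : Fin 2 → ℝ, (∀ i, |k i| ≤ π) → ‖fderiv ℝ (fderiv ℝ (fderiv ℝ δ)) k‖ ≤ κ₃)
    {x y : Fin 2 → ℝ} (hx : ∀ i, |x i| ≤ π) (hy : ∀ i, |y i| ≤ π) :
    ‖fderiv ℝ (fderiv ℝ (fun k : Fin 2 → ℝ => sqDispersion k + δ k)) x -
        fderiv ℝ (fderiv ℝ (fun k : Fin 2 → ℝ => sqDispersion k + δ k)) y‖ ≤ (4 + κ₃) * ‖x - y‖ := by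
  have hC : ContDiff ℝ 2 (fderiv ℝ (fderiv ℝ (fun k : Fin 2 → ℝ => sqDispersion k + δ k))) :=
    ((contDiff_pertBand hδs).fderiv_right (m := 3) (by norm_num)).fderiv_right (by norm_num)
  exact (convex_closedSquare).norm_image_sub_le_of_norm_fderiv_le (fun z _ => (hC.differentiable (by norm_num)) z)
    (fun z hz => norm_fderiv_three_pertBand_le_of_mem hδs hκ₃ hz) hy hx

end OneBand

section Splits

variable {δ δ' : (Fin 2 → ℝ) → ℝ} (hδs : ContDiff ℝ 4 δ) (hδs' : ContDiff ℝ 4 δ')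
include hδs hδs'

/-- `D(ε₀ + δ′)(x) = D(ε₀ + δ)(x) + (Dδ′(x) − Dδ(x))`. [folklore] -/
theorem fderiv_pertBand_sub (x : Fin 2 → ℝ) :
    fderiv ℝ (fun k : Fin 2 → ℝ => sqDispersion k + δ' k) x =
      fderiv ℝ (fun k : Fin 2 → ℝ => sqDispersion k + δ k) x + (fderiv ℝ δ' x - fderiv ℝ δ x) := by
  have h0 : DifferentiableAt ℝ sqDispersion x := (contDiff_sqDispersion (m := 1)).differentiable one_ne_zero x
  have h1 : DifferentiableAt ℝ δ x := (hδs.differentiable (by norm_num)) x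
  have h2 : DifferentiableAt ℝ δ' x := (hδs'.differentiable (by norm_num)) x
  rw [show (fun k : Fin 2 → ℝ => sqDispersion k + δ' k) = sqDispersion + δ' from rfl,
    show (fun k : Fin 2 → ℝ => sqDispersion k + δ k) = sqDispersion + δ from rfl, fderiv_add h0 h2, fderiv_add h0 h1]
  abel

/-- `D²(ε₀ + δ′)(x) = D²(ε₀ + δ)(x) + (D²δ′(x) − D²δ(x))` (nested Fréchet derivatives). [folklore] -/
theorem fderiv_two_pertBand_sub (x : Fin 2 → ℝ) :
    fderiv ℝ (fderiv ℝ (fun k : Fin 2 → ℝ => sqDispersion k + δ' k)) x =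
      fderiv ℝ (fderiv ℝ (fun k : Fin 2 → ℝ => sqDispersion k + δ k)) x + (fderiv ℝ (fderiv ℝ δ') x - fderiv ℝ (fderiv ℝ δ) x) := by
  have h0 : Differentiable ℝ sqDispersion := (contDiff_sqDispersion (m := 1)).differentiable one_ne_zero
  have h1 : Differentiable ℝ δ := hδs.differentiable (by norm_num)
  have h2 : Differentiable ℝ δ' := hδs'.differentiable (by norm_num)
  have e1 : fderiv ℝ (fun k : Fin 2 → ℝ => sqDispersion k + δ k) = fderiv ℝ sqDispersion + fderiv ℝ δ := by
    funext y; exact fderiv_add (h0 y) (h1 y)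
  have e2 : fderiv ℝ (fun k : Fin 2 → ℝ => sqDispersion k + δ' k) = fderiv ℝ sqDispersion + fderiv ℝ δ' := by
    funext y; exact fderiv_add (h0 y) (h2 y)
  have g0 : DifferentiableAt ℝ (fderiv ℝ sqDispersion) x :=
    ((contDiff_sqDispersion (m := 2)).fderiv_right (m := 1) (by norm_num)).differentiable one_ne_zero x
  have g1 : DifferentiableAt ℝ (fderiv ℝ δ) x := ((hδs.fderiv_right (m := 3) (by norm_num)).differentiable (by norm_num)) x
  have g2 : DifferentiableAt ℝ (fderiv ℝ δ') x := ((hδs'.fderiv_right (m := 3) (by norm_num)).differentiable (by norm_num)) x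
  rw [e1, e2, fderiv_add g0 g2, fderiv_add g0 g1]
  abel

end Splits

/-! ## §2 Two root selections: orders zero, one, two -/

section TwoBands

variable {a b : ℝ} (B : BandBounds a b) {δ δ' : (Fin 2 → ℝ) → ℝ} (hδs : ContDiff ℝ 4 δ) (hδs' : ContDiff ℝ 4 δ')
  {κ₀ κ₁ μ : ℝ} (hδ : ∀ k : Fin 2 → ℝ, (∀ i, |k i| ≤ π) → |δ k| ≤ κ₀) (hδ' : ∀ k : Fin 2 → ℝ, (∀ i, |k i| ≤ π) → |δ' k| ≤ κ₀)
  (hlo : a ≤ μ - κ₀) (hhi : μ + κ₀ ≤ b)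
  (hκ : ∀ k : Fin 2 → ℝ, (∀ i, |k i| ≤ π) → ‖fderiv ℝ δ k‖ ≤ κ₁) (hκ' : ∀ k : Fin 2 → ℝ, (∀ i, |k i| ≤ π) → ‖fderiv ℝ δ' k‖ ≤ κ₁)
  (hκ₁ : κ₁ < B.Dtmin)
  {u v : ℝ → ℝ} (hu : ∀ θ, IsBandFermiRadius (μ - δ (u θ • dir θ)) θ (u θ)) (hv : ∀ θ, IsBandFermiRadius (μ - δ' (v θ • dir θ)) θ (v θ))
  {E₀ : ℝ} (hE₀ : ∀ k : Fin 2 → ℝ, (∀ i, |k i| ≤ π) → |δ' k - δ k| ≤ E₀)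
include B hδs hδs' hδ hδ' hlo hhi hκ hκ' hκ₁ hu hv hE₀

omit hδs' hκ' in
/-- **Order 0** (p1b's `mul_abs_sub_le_of_shifted_two`, named for root selections): `|v θ − u θ| ≤ E₀/(Dt_min − κ₁)`.
[cite: BenfattoGiulianiMastropietro2006, §2.4 Lemma 2.1 (2.40)] -/
theorem abs_root_sub_root_le (θ : ℝ) : |v θ - u θ| ≤ E₀ / (B.Dtmin - κ₁) := by
  have hL := radialLipschitz_of_fderiv_le (fun k _ => (hδs.differentiable (by norm_num)) k) hκ θ
  have h := mul_abs_sub_le_of_shifted_two B hδ hδ' hlo hhi hL (hu θ) (hv θ)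
  rw [abs_sub_comm] at h
  rw [le_div_iff₀ (sub_pos.2 hκ₁), mul_comm]
  refine h.trans ?_
  rw [abs_sub_comm]; exact hE₀ _ (abs_apply_le_pi_of_isBandFermiRadius (hv θ))

omit hδs' hκ' in
/-- The two curve points are `|v − u|`-close in the sup norm. [folklore] -/
theorem norm_root_smul_sub_le (θ : ℝ) : ‖v θ • dir θ - u θ • dir θ‖ ≤ E₀ / (B.Dtmin - κ₁) := by
  rw [← sub_smul, norm_smul, Real.norm_eq_abs]
  exact (mul_le_of_le_one_right (abs_nonneg _) (norm_dir_le_one θ)).trans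
    (abs_root_sub_root_le B hδs hδ hδ' hlo hhi hκ hκ₁ hu hv hE₀ θ)

omit hκ' in
/-- **Δ₁**: `‖D(ε₀+δ′)(v·dir) − D(ε₀+δ)(u·dir)‖ ≤ (4+κ₂)·E₀/(Dt_min−κ₁) + E₁`. [folklore] -/
theorem norm_fderiv_two_roots_sub_le {κ₂ E₁ : ℝ} (hκ₂ : ∀ k : Fin 2 → ℝ, (∀ i, |k i| ≤ π) → ‖fderiv ℝ (fderiv ℝ δ) k‖ ≤ κ₂)
    (hE₁ : ∀ k : Fin 2 → ℝ, (∀ i, |k i| ≤ π) → ‖fderiv ℝ δ' k - fderiv ℝ δ k‖ ≤ E₁) (θ : ℝ) :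
    ‖fderiv ℝ (fun k : Fin 2 → ℝ => sqDispersion k + δ' k) (v θ • dir θ) -
        fderiv ℝ (fun k : Fin 2 → ℝ => sqDispersion k + δ k) (u θ • dir θ)‖ ≤
      (4 + κ₂) * (E₀ / (B.Dtmin - κ₁)) + E₁ := by
  have hsv := abs_apply_le_pi_of_isBandFermiRadius (hv θ)
  have hsu := abs_apply_le_pi_of_isBandFermiRadius (hu θ)
  rw [fderiv_pertBand_sub hδs hδs' (v θ • dir θ)]
  have e : fderiv ℝ (fun k : Fin 2 → ℝ => sqDispersion k + δ k) (v θ • dir θ) + (fderiv ℝ δ' (v θ • dir θ) - fderiv ℝ δ (v θ • dir θ)) -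
      fderiv ℝ (fun k : Fin 2 → ℝ => sqDispersion k + δ k) (u θ • dir θ) =
      (fderiv ℝ (fun k : Fin 2 → ℝ => sqDispersion k + δ k) (v θ • dir θ) -
        fderiv ℝ (fun k : Fin 2 → ℝ => sqDispersion k + δ k) (u θ • dir θ)) +
        (fderiv ℝ δ' (v θ • dir θ) - fderiv ℝ δ (v θ • dir θ)) := by abel
  rw [e]
  refine (norm_add_le _ _).trans (add_le_add ?_ (hE₁ _ hsv))
  have hκ₂0 : 0 ≤ 4 + κ₂ := by
    have := (norm_nonneg _).trans (hκ₂ _ hsu); linarith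
  exact (norm_fderiv_pertBand_sub_le hδs hκ₂ hsv hsu).trans
    (mul_le_mul_of_nonneg_left (norm_root_smul_sub_le B hδs hδ hδ' hlo hhi hκ hκ₁ hu hv hE₀ θ) hκ₂0)

omit hκ' in
/-- **Δ₂**: `‖D²(ε₀+δ′)(v·dir) − D²(ε₀+δ)(u·dir)‖ ≤ (4+κ₃)·E₀/(Dt_min−κ₁) + E₂`. [folklore] -/
theorem norm_fderiv_two_two_roots_sub_le {κ₃ E₂ : ℝ}
    (hκ₃ : ∀ k : Fin 2 → ℝ, (∀ i, |k i| ≤ π) → ‖fderiv ℝ (fderiv ℝ (fderiv ℝ δ)) k‖ ≤ κ₃)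
    (hE₂ : ∀ k : Fin 2 → ℝ, (∀ i, |k i| ≤ π) → ‖fderiv ℝ (fderiv ℝ δ') k - fderiv ℝ (fderiv ℝ δ) k‖ ≤ E₂) (θ : ℝ) :
    ‖fderiv ℝ (fderiv ℝ (fun k : Fin 2 → ℝ => sqDispersion k + δ' k)) (v θ • dir θ) -
        fderiv ℝ (fderiv ℝ (fun k : Fin 2 → ℝ => sqDispersion k + δ k)) (u θ • dir θ)‖ ≤
      (4 + κ₃) * (E₀ / (B.Dtmin - κ₁)) + E₂ := by
  have hsv := abs_apply_le_pi_of_isBandFermiRadius (hv θ)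
  have hsu := abs_apply_le_pi_of_isBandFermiRadius (hu θ)
  rw [fderiv_two_pertBand_sub hδs hδs' (v θ • dir θ)]
  have e : fderiv ℝ (fderiv ℝ (fun k : Fin 2 → ℝ => sqDispersion k + δ k)) (v θ • dir θ) +
        (fderiv ℝ (fderiv ℝ δ') (v θ • dir θ) - fderiv ℝ (fderiv ℝ δ) (v θ • dir θ)) -
      fderiv ℝ (fderiv ℝ (fun k : Fin 2 → ℝ => sqDispersion k + δ k)) (u θ • dir θ) =
      (fderiv ℝ (fderiv ℝ (fun k : Fin 2 → ℝ => sqDispersion k + δ k)) (v θ • dir θ) -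
        fderiv ℝ (fderiv ℝ (fun k : Fin 2 → ℝ => sqDispersion k + δ k)) (u θ • dir θ)) +
        (fderiv ℝ (fderiv ℝ δ') (v θ • dir θ) - fderiv ℝ (fderiv ℝ δ) (v θ • dir θ)) := by abel
  rw [e]
  refine (norm_add_le _ _).trans (add_le_add ?_ (hE₂ _ hsv))
  have hκ₃0 : 0 ≤ 4 + κ₃ := by
    have := (norm_nonneg _).trans (hκ₃ _ hsu); linarith
  exact (norm_fderiv_two_pertBand_sub_le hδs hκ₃ hsv hsu).trans
    (mul_le_mul_of_nonneg_left (norm_root_smul_sub_le B hδs hδ hδ' hlo hhi hκ hκ₁ hu hv hE₀ θ) hκ₃0)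

/-- **ORDER 1, TWO FRAMES.**  With `W₀ = E₀/(Dt_min − κ₁)`, `R₁ = (4+κ₁)π√2/(Dt_min − κ₁)` (the common slope bound), `‖D²δ‖ ≤ κ₂`,
`‖Dδ′ − Dδ‖ ≤ E₁` on the closed square:
`|v′ θ − u′ θ| ≤ ((4+κ₁)·W₀ + (π√2 + R₁)·((4+κ₂)W₀ + E₁))/(Dt_min − κ₁)` — linear in `(E₀, E₁)`.
[cite: BenfattoGiulianiMastropietro2006, §2.4 Lemma 2.1 (2.40)] -/
theorem abs_deriv_root_sub_le {κ₂ E₁ : ℝ} (hκ₂ : ∀ k : Fin 2 → ℝ, (∀ i, |k i| ≤ π) → ‖fderiv ℝ (fderiv ℝ δ) k‖ ≤ κ₂)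
    (hE₁ : ∀ k : Fin 2 → ℝ, (∀ i, |k i| ≤ π) → ‖fderiv ℝ δ' k - fderiv ℝ δ k‖ ≤ E₁) (θ : ℝ) :
    |deriv v θ - deriv u θ| ≤
      ((4 + κ₁) * (E₀ / (B.Dtmin - κ₁)) +
        (π * Real.sqrt 2 + (4 + κ₁) * (π * Real.sqrt 2) / (B.Dtmin - κ₁)) * ((4 + κ₂) * (E₀ / (B.Dtmin - κ₁)) + E₁)) /
        (B.Dtmin - κ₁) :=
  abs_deriv_sub_le_of_polar_levels (contDiff_pertBand hδs) (contDiff_pertBand hδs')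
    (contDiff_four_of_isRoot B hδs hδ hlo hhi hκ hκ₁ hu) (contDiff_four_of_isRoot B hδs' hδ' hlo hhi hκ' hκ₁ hv)
    (pertBand_level hu) (pertBand_level hv) (sub_pos.2 hκ₁)
    (Dtmin_sub_le_fderiv_pertBand_dir B hδ' hlo hhi hκ' hv hδs' θ) (norm_fderiv_pertBand_le hδs' hκ' hv θ)
    (norm_fderiv_two_roots_sub_le B hδs hδs' hδ hδ' hlo hhi hκ hκ₁ hu hv hE₀ hκ₂ hE₁ θ)
    (abs_root_le_pi_mul_sqrt_two B hδ hlo hhi hu θ) (abs_deriv_le_uniform B hδs hδ hlo hhi hκ hκ₁ hu θ)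
    (abs_root_sub_root_le B hδs hδ hδ' hlo hhi hκ hκ₁ hu hv hE₀ θ)

/-- **ORDER 2, TWO FRAMES (incremental form).**  With `‖D²δ‖, ‖D²δ′‖ ≤ κ₂`, `‖D³δ‖ ≤ κ₃`, `‖Dδ′ − Dδ‖ ≤ E₁`, `‖D²δ′ − D²δ‖ ≤ E₂` on the
closed square, bounds `R₁ ≥ |u′|, |v′|`, `R₂ ≥ |u″|` and `W₁ ≥ |v′ − u′|` at `θ`, `W₀ = E₀/(Dt_min − κ₁)`, `Δ₁ = (4+κ₂)W₀ + E₁`,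
`Δ₂ = (4+κ₃)W₀ + E₂`, `K₁ = R₁ + π√2`:
`|v″ θ − u″ θ| ≤ W₀ + (Δ₂K₁² + 2(4+κ₂)K₁(W₁+W₀) + Δ₁(2R₁+π√2) + (4+κ₁)(W₀+2W₁) + (R₂+π√2)Δ₁)/(Dt_min − κ₁)` — linear in `(E₀, E₁, E₂, W₁)`.
[cite: BenfattoGiulianiMastropietro2006, §2.4 Lemma 2.1 (2.40)] -/
theorem abs_deriv_two_root_sub_le {κ₂ κ₃ E₁ E₂ : ℝ} (hκ₂ : ∀ k : Fin 2 → ℝ, (∀ i, |k i| ≤ π) → ‖fderiv ℝ (fderiv ℝ δ) k‖ ≤ κ₂)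
    (hκ₃ : ∀ k : Fin 2 → ℝ, (∀ i, |k i| ≤ π) → ‖fderiv ℝ (fderiv ℝ (fderiv ℝ δ)) k‖ ≤ κ₃)
    (hE₁ : ∀ k : Fin 2 → ℝ, (∀ i, |k i| ≤ π) → ‖fderiv ℝ δ' k - fderiv ℝ δ k‖ ≤ E₁)
    (hE₂ : ∀ k : Fin 2 → ℝ, (∀ i, |k i| ≤ π) → ‖fderiv ℝ (fderiv ℝ δ') k - fderiv ℝ (fderiv ℝ δ) k‖ ≤ E₂)
    {θ R₁ R₂ W₁ : ℝ} (hR₁ : |deriv u θ| ≤ R₁) (hR₁' : |deriv v θ| ≤ R₁) (hR₂ : |deriv (deriv u) θ| ≤ R₂)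
    (hW₁ : |deriv v θ - deriv u θ| ≤ W₁) :
    |deriv (deriv v) θ - deriv (deriv u) θ| ≤
      E₀ / (B.Dtmin - κ₁) +
        (((4 + κ₃) * (E₀ / (B.Dtmin - κ₁)) + E₂) * (R₁ + π * Real.sqrt 2) ^ 2 +
          2 * (4 + κ₂) * (R₁ + π * Real.sqrt 2) * (W₁ + E₀ / (B.Dtmin - κ₁)) +
          ((4 + κ₂) * (E₀ / (B.Dtmin - κ₁)) + E₁) * (2 * R₁ + π * Real.sqrt 2) +
          (4 + κ₁) * (E₀ / (B.Dtmin - κ₁) + 2 * W₁) +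
          (R₂ + π * Real.sqrt 2) * ((4 + κ₂) * (E₀ / (B.Dtmin - κ₁)) + E₁)) / (B.Dtmin - κ₁) :=
  abs_deriv_two_sub_le_of_polar_levels (contDiff_pertBand hδs) (contDiff_pertBand hδs')
    (contDiff_four_of_isRoot B hδs hδ hlo hhi hκ hκ₁ hu) (contDiff_four_of_isRoot B hδs' hδ' hlo hhi hκ' hκ₁ hv)
    (pertBand_level hu) (pertBand_level hv) (sub_pos.2 hκ₁)
    (Dtmin_sub_le_fderiv_pertBand_dir B hδ' hlo hhi hκ' hv hδs' θ) (norm_fderiv_pertBand_le hδs hκ hu θ)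
    (norm_fderiv_two_pertBand_le hδs hu hκ₂ θ)
    (norm_fderiv_two_roots_sub_le B hδs hδs' hδ hδ' hlo hhi hκ hκ₁ hu hv hE₀ hκ₂ hE₁ θ)
    (norm_fderiv_two_two_roots_sub_le B hδs hδs' hδ hδ' hlo hhi hκ hκ₁ hu hv hE₀ hκ₃ hE₂ θ)
    (abs_root_le_pi_mul_sqrt_two B hδ hlo hhi hu θ) (abs_root_le_pi_mul_sqrt_two B hδ' hlo hhi hv θ) hR₁ hR₁' hR₂
    (abs_root_sub_root_le B hδs hδ hδ' hlo hhi hκ hκ₁ hu hv hE₀ θ) hW₁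

end TwoBands

end Summit.HubbardSuperconductivity.HubbardSuperconductivity.Theorems.PerturbedFermiCurve

end
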